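import Literature.Topology.FourManifolds.TubularNbhdConeTube
import Literature.Topology.FourManifolds.SliceRibbon
import Literature.Topology.FourManifolds.FramedTubularNbhd
import Literature.Topology.FourManifolds.KirbyMovesShrinkProofs
import HarnessLib

/-!
# The conical tube of a slice disc from a transversal framing

Topic `Literature/Topology/FourManifolds`; fact seat of
`Literature.Topology.FourManifolds.Knot.ManolescuPiccirillo2023_lemma33_sphere` (Manolescu–Piccirillo (2023),
Lemma 3.3 for `W = S⁴`). This file proves the *constructive* content of the named fact
`Knot.IsSliceDisc.exists_conicalTube_hasFraming_zero` (`SliceDiscEndCollarFacts.lean`; the neat tubular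
neighbourhood of a conical slice disc, Kosinski, *Differential Manifolds* (1993), Ch. III (4.1)–(4.2)):
from

* a slice disc `g` of the knot `K` (`Knot.IsSliceDisc`) which is the cone `g (t • u) = t • K u` on the
  band `1 - s₁ ≤ t ≤ 1`,
* an oriented tubular neighbourhood `ν : 𝕊¹ × ℝ² ↪ 𝕊³` of `K`, and
* a **transversal framing** `n 0, n 1 : ℝ² → ℝ⁴` of the open disc (`C^∞`, with
  `(v, a) ↦ dgₓ v + ∑ aᵢ • nᵢ x` injective) which over a wider band `1 - s₂ < t < 1` is **conical over
  `ν`**, `nᵢ (t • u) = t • ∂_{wᵢ}|₀ ν(u, ·)`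

(bundled as `ConicalFraming K`), it builds the trivialised tubular neighbourhood
`G : D̊² × B(0, 2) → B̊⁴` of the open disc with all the properties of that fact
(`ConicalFraming.exists_conicalTube`, `ConicalFraming.exists_conicalTube_hasFraming`,
`Knot.IsSliceDisc.exists_conicalTube_of_conicalFraming`): a `C^∞` injective immersion into the open unit
ball, `G (x, 0) = g x`, `G (t • u, w) = t • ν'(u, w)` over the band `1 - s₁ < t < 1` for the rescaled
tube `ν' = ν.scale c` (`KirbyMovesShrinkProofs.lean`; same framing integer, `HasFraming.scale`), and
`‖G (x, w)‖ ≤ 1 - s₀` for `‖x‖ ≤ 1 - s₀`. What remains of the named fact are its two classical inputs: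
the existence of such a framing conical over some `ν` (trivial normal bundle of the disc, neat tubular
neighbourhoods: Kosinski (1993), Ch. III (4.2)) and `ν.HasFraming 0` for it (Kirby, *The Topology of
4-Manifolds* (1989), Ch. I §2, p. 6: the zero framing is the one extending over the normal bundle of a
surface in `B⁴` bounded by the knot).

## Construction

With `δ = (s₂ - s₁)/3`, `r₁ = 1 - s₂ + δ < r₂ = 1 - s₂ + 2δ < 1 - s₁` and a `C^∞` cutoff `cut` (`0` below
`r₁`, `1` above `r₂`), the **unscaled tube** is

  `G₀ (x, w) = A (x, w) + cut ‖x‖ • (C (x, w) - C (x, 0) - ∑ wᵢ • nᵢ x)`,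

`A (x, w) = g x + ∑ wᵢ • nᵢ x` the affine tube on the framing and `C = ν.coneTube`
(`TubularNbhdConeTube.lean`) the cone `‖x‖ • ν(x/‖x‖, w)`. Then `G₀ (x, 0) = g x`; `G₀ = A` below `r₁`;
`G₀ = C + (g - C(·, 0))` above `r₂`, which is `C` itself on the conical band (`tube₀_eq_coneTube`);
`G₀` is `C^∞` on all of `ℝ² × ℝ²` (`contDiff_tube₀`); and along the zero section over the open disc
its differential is `(v, a) ↦ dgₓ v + ∑ aᵢ • nᵢ x` (`hasFDerivAt_tube₀_zero`: the correction vanishes on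
the zero section and, the framing being conical over `ν` above `1 - s₂`, has vanishing fibre derivative
wherever the cutoff is nonzero), injective by transversality. Compactness of the deep disc then gives a
fibre radius on which `G₀` is injective (`exists_injOn`, from `exists_injOn_prod_ball` of
`FramedTubularNbhd.lean` and the inverse function theorem), immersive (`exists_fderiv_mem_range`,
invertibility being open) and of norm `< ρ < 1` over `‖x‖ ≤ 1 - s₁` (`exists_norm_lt`), while over
the band it is the cone tube: injective, immersive (`det_pos` of `ν`,
`Knot.TubularNbhd.injective_fderiv_coneTube`) and of norm `‖x‖`, which separates it from the deep part.
The tube is `G (x, w) = G₀ (x, c • w)` for a small fibre scale `c`.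

## References

* A. A. Kosinski, *Differential Manifolds*, Academic Press (1993), Ch. III (4.1)–(4.2).
  [cite: Kosinski1993, Ch. III Thm (4.2)]
* R. C. Kirby, *The Topology of 4-Manifolds*, LNM 1374 (1989), Ch. I §2, p. 6. [cite: Kirby1989, Ch. I §2]
* M. W. Hirsch, *Differential Topology*, GTM 33 (1976), Ch. 4 §5, proof of Thm. 5.1 (injectivity on a
  tube about an injectively mapped compact zero section). [cite: Hirsch1976, Ch. 4 §5 Thm. 5.1]
* C. Manolescu, L. Piccirillo, *From zero surgeries to candidates for exotic definite 4-manifolds*,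
  J. London Math. Soc. (2023), proof of Lemma 3.3. [cite: ManolescuPiccirillo2023, proof of Lemma 3.3]

## Design notes

* All maps are bare functions between model spaces; the datum is the structure `ConicalFraming K` so
  that the thirty-odd intermediate lemmas have short statements, and the headline is restated
  unbundled, in the exact shape of `Knot.IsSliceDisc.exists_conicalTube_hasFraming_zero` with the
  framing integer `m` of `ν` as a parameter (`Knot.IsSliceDisc.exists_conicalTube_of_conicalFraming`).
* No declaration in this file uses `sorry`; notation `𝔼 n`, `𝕊 n` is local.
-/

noncomputable section

open Set Metric Function Filter
open scoped Manifold ContDiff Topology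

namespace Literature.Topology.FourManifolds

/-- Local notation: `𝔼 n` is the model Euclidean space `EuclideanSpace ℝ (Fin n)`. -/
local notation "𝔼 " n:arg => EuclideanSpace ℝ (Fin n)

/-- Local notation: `𝕊 n` is the unit sphere in `EuclideanSpace ℝ (Fin (n + 1))`. -/
local notation "𝕊 " n:arg => (Metric.sphere (0 : EuclideanSpace ℝ (Fin (n + 1))) 1)

attribute [local instance] fact_finrank_euclideanSpace_two fact_finrank_euclideanSpace_four

/-! ### The datum: a conical slice disc with a transversal framing conical over a tube of the knot -/

/-- **A conical slice disc with a conical transversal framing.** The input of the tube construction: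
a slice disc `g` of the knot `K` which is the cone `g (t • u) = t • K u` on the band `1 - s₁ ≤ t ≤ 1`,
an oriented tubular neighbourhood `ν` of `K` in `𝕊³`, and two vector fields `n 0, n 1` along the open
disc, `C^∞`, transverse to the disc (`dgₓ v + ∑ aᵢ • nᵢ x = 0` only trivially), and over the wider band
`1 - s₂ < t < 1` equal to the cone `nᵢ (t • u) = t • ∂_{wᵢ}|₀ ν(u, ·)` on the fibre derivative of `ν`.
[folklore] -/
structure ConicalFraming (K : Knot) where
  /-- The slice disc. -/
  g : 𝔼 2 → 𝔼 4
  /-- Width of the band on which the disc is conical. -/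
  s₁ : ℝ
  /-- Width of the band on which the framing is conical over `ν`. -/
  s₂ : ℝ
  /-- The tubular neighbourhood of the knot. -/
  ν : Knot.TubularNbhd K
  /-- The transversal framing of the disc. -/
  n : Fin 2 → 𝔼 2 → 𝔼 4
  isSliceDisc : K.IsSliceDisc g
  s₁_pos : 0 < s₁
  s₁_lt_s₂ : s₁ < s₂
  s₂_lt_one : s₂ < 1
  g_cone : ∀ (u : 𝕊 1) (t : ℝ), 1 - s₁ ≤ t → t ≤ 1 →
    g (t • (u : 𝔼 2)) = t • ((K u : 𝕊 3) : 𝔼 4)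
  contDiffOn_n : ∀ i, ContDiffOn ℝ ∞ (n i) (ball (0 : 𝔼 2) 1)
  transversal : ∀ x ∈ ball (0 : 𝔼 2) 1, ∀ (v a : 𝔼 2),
    fderiv ℝ g x v + ∑ i, a i • n i x = 0 → v = 0 ∧ a = 0
  n_cone : ∀ (i : Fin 2) (u : 𝕊 1) (t : ℝ), 1 - s₂ < t → t < 1 →
    n i (t • (u : 𝔼 2)) =
      t • fderiv ℝ (fun w : 𝔼 2 ↦ ((ν (u, w) : 𝕊 3) : 𝔼 4)) 0 (EuclideanSpace.single i 1)

namespace ConicalFraming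

variable {K : Knot} (D : ConicalFraming K)

/-! ### Widths and the cutoff -/

/-- A third of the gap between the two bands. [folklore] -/
def δ : ℝ := (D.s₂ - D.s₁) / 3

/-- Below this radius the tube is the affine tube. [folklore] -/
def r₁ : ℝ := 1 - D.s₂ + D.δ

/-- Above this radius the tube is the corrected cone tube. [folklore] -/
def r₂ : ℝ := 1 - D.s₂ + 2 * D.δ

/-- `δ > 0`. [folklore] -/
theorem δ_pos : 0 < D.δ := by
  have := D.s₁_lt_s₂
  unfold δ
  linarith

/-- `s₁ < 1`. [folklore] -/
theorem s₁_lt_one : D.s₁ < 1 := D.s₁_lt_s₂.trans D.s₂_lt_one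

/-- `0 < 1 - s₂`. [folklore] -/
theorem one_sub_s₂_pos : 0 < 1 - D.s₂ := by linarith [D.s₂_lt_one]

/-- The framing band starts below `r₁`: `1 - s₂ < r₁`. [folklore] -/
theorem one_sub_s₂_lt_r₁ : 1 - D.s₂ < D.r₁ := by
  have := D.δ_pos
  unfold r₁
  linarith

/-- `0 < r₁`. [folklore] -/
theorem r₁_pos : 0 < D.r₁ := D.one_sub_s₂_pos.trans D.one_sub_s₂_lt_r₁

/-- `r₁ < r₂`. [folklore] -/
theorem r₁_lt_r₂ : D.r₁ < D.r₂ := by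
  have := D.δ_pos
  unfold r₁ r₂
  linarith

/-- `r₂ = 1 - s₁ - δ`. [folklore] -/
theorem r₂_eq : D.r₂ = 1 - D.s₁ - D.δ := by
  unfold r₂ δ
  ring

/-- The cutoff is saturated below the conical band: `r₂ < 1 - s₁`. [folklore] -/
theorem r₂_lt : D.r₂ < 1 - D.s₁ := by
  rw [r₂_eq]
  linarith [D.δ_pos]

/-- `r₂ < 1`. [folklore] -/
theorem r₂_lt_one : D.r₂ < 1 := D.r₂_lt.trans_le (by linarith [D.s₁_pos])

/-- `r₁ < 1`. [folklore] -/
theorem r₁_lt_one : D.r₁ < 1 := D.r₁_lt_r₂.trans D.r₂_lt_one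

/-- The cutoff in the radius: `0` below `r₁`, `1` above `r₂`, `C^∞`. [folklore] -/
def cut (r : ℝ) : ℝ := Real.smoothTransition ((r - D.r₁) / D.δ)

/-- The cutoff vanishes below `r₁`. [folklore] -/
theorem cut_of_le {r : ℝ} (hr : r ≤ D.r₁) : D.cut r = 0 :=
  Real.smoothTransition.zero_of_nonpos (div_nonpos_of_nonpos_of_nonneg (by linarith) D.δ_pos.le)

/-- The cutoff is `1` above `r₂`. [folklore] -/
theorem cut_of_ge {r : ℝ} (hr : D.r₂ ≤ r) : D.cut r = 1 := by
  refine Real.smoothTransition.one_of_one_le ?_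
  rw [le_div_iff₀ D.δ_pos]
  have : D.r₂ = D.r₁ + D.δ := by unfold r₁ r₂; ring
  linarith

/-- The cutoff is `C^∞`. [folklore] -/
theorem contDiff_cut : ContDiff ℝ ∞ D.cut :=
  Real.smoothTransition.contDiff.comp ((contDiff_id.sub contDiff_const).div_const _)

/-! ### The pieces of the tube -/

/-- The **affine tube** `A(x, w) = g x + ∑ wᵢ • nᵢ x` on the framing (the deep part). [folklore] -/
def affine (q : (𝔼 2) × (𝔼 2)) : 𝔼 4 := D.g q.1 + ∑ i, q.2 i • D.n i q.1

/-- The **correction** `coneTube (x, w) - coneTube (x, 0) - ∑ wᵢ • nᵢ x`: adding it to the affine tube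
gives the cone tube translated to the disc, `coneTube (x, w) + (g x - coneTube (x, 0))`. [folklore] -/
def corr (q : (𝔼 2) × (𝔼 2)) : 𝔼 4 :=
  D.ν.coneTube q - D.ν.coneTube (q.1, 0) - ∑ i, q.2 i • D.n i q.1

/-- The **unscaled tube** `G₀ = A + cut(‖x‖) • corr`: the affine tube on `‖x‖ ≤ r₁`, the translated
cone tube on `‖x‖ ≥ r₂`, hence the cone tube itself on the conical band of the disc. [folklore] -/
def tube₀ (q : (𝔼 2) × (𝔼 2)) : 𝔼 4 := D.affine q + D.cut ‖q.1‖ • D.corr q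

/-- The affine tube, with the sum over `Fin 2` expanded. [folklore] -/
theorem affine_apply (x w : 𝔼 2) :
    D.affine (x, w) = D.g x + w 0 • D.n 0 x + w 1 • D.n 1 x := by
  simp [affine, Fin.sum_univ_two, add_assoc]

/-- The correction, with the sum over `Fin 2` expanded. [folklore] -/
theorem corr_apply (x w : 𝔼 2) :
    D.corr (x, w) = D.ν.coneTube (x, w) - D.ν.coneTube (x, 0) - (w 0 • D.n 0 x + w 1 • D.n 1 x) := by
  simp [corr, Fin.sum_univ_two]

/-- Unfolding of the unscaled tube. [folklore] -/
theorem tube₀_apply (x w : 𝔼 2) :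
    D.tube₀ (x, w) = D.affine (x, w) + D.cut ‖x‖ • D.corr (x, w) := rfl

/-- On the zero section the affine tube is the disc. [folklore] -/
@[simp]
theorem affine_fst_zero (x : 𝔼 2) : D.affine (x, 0) = D.g x := by
  simp [affine_apply]

/-- On the zero section the correction vanishes. [folklore] -/
@[simp]
theorem corr_fst_zero (x : 𝔼 2) : D.corr (x, 0) = 0 := by
  simp [corr_apply]

/-- **On the zero section the tube is the disc**: `G₀ (x, 0) = g x` (all `x`). [folklore] -/
@[simp]
theorem tube₀_fst_zero (x : 𝔼 2) : D.tube₀ (x, 0) = D.g x := by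
  simp [tube₀_apply]

/-- Below `r₁` the tube is the affine tube. [folklore] -/
theorem tube₀_of_le {x : 𝔼 2} (hx : ‖x‖ ≤ D.r₁) (w : 𝔼 2) : D.tube₀ (x, w) = D.affine (x, w) := by
  rw [tube₀_apply, D.cut_of_le hx, zero_smul, add_zero]

/-- Above `r₂` the tube is the cone tube translated to the disc. [folklore] -/
theorem tube₀_of_ge {x : 𝔼 2} (hx : D.r₂ ≤ ‖x‖) (w : 𝔼 2) :
    D.tube₀ (x, w) = D.ν.coneTube (x, w) + (D.g x - D.ν.coneTube (x, 0)) := by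
  rw [tube₀_apply, D.cut_of_ge hx, one_smul, affine_apply, corr_apply]
  abel

/-- On the conical band the disc is the zero section of the cone tube. [folklore] -/
theorem g_eq_coneTube {x : 𝔼 2} (h1 : 1 - D.s₁ ≤ ‖x‖) (h2 : ‖x‖ ≤ 1) :
    D.g x = D.ν.coneTube (x, 0) := by
  have hx0 : 0 < ‖x‖ := by linarith [D.s₁_lt_one]
  conv_lhs => rw [← norm_smul_coe_radialProjection (spherePt 1) x]
  rw [D.g_cone _ _ h1 h2, D.ν.coneTube_fst_zero]

/-- **On the conical band the tube is the cone tube**: `G₀ (x, w) = coneTube (x, w)` for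
`1 - s₁ ≤ ‖x‖ ≤ 1`. [folklore] -/
theorem tube₀_eq_coneTube {x : 𝔼 2} (h1 : 1 - D.s₁ ≤ ‖x‖) (h2 : ‖x‖ ≤ 1) (w : 𝔼 2) :
    D.tube₀ (x, w) = D.ν.coneTube (x, w) := by
  rw [D.tube₀_of_ge (D.r₂_lt.le.trans h1), D.g_eq_coneTube h1 h2, sub_self, add_zero]

/-- The cone form on the band: `G₀ (t • u, w) = t • ν(u, w)` for `1 - s₁ ≤ t ≤ 1`. [folklore] -/
theorem tube₀_smul_coe {t : ℝ} (h1 : 1 - D.s₁ ≤ t) (h2 : t ≤ 1) (u : 𝕊 1) (w : 𝔼 2) :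
    D.tube₀ (t • (u : 𝔼 2), w) = t • ((D.ν (u, w) : 𝕊 3) : 𝔼 4) := by
  have ht : 0 < t := by linarith [D.s₁_lt_one]
  have hn : ‖t • (u : 𝔼 2)‖ = t := norm_smul_coe_sphere ht.le u
  rw [D.tube₀_eq_coneTube (by rw [hn]; exact h1) (by rw [hn]; exact h2), D.ν.coneTube_smul_coe ht]

/-- The norm of the tube on the conical band is the radius. [folklore] -/
theorem norm_tube₀_of_band {x : 𝔼 2} (h1 : 1 - D.s₁ ≤ ‖x‖) (h2 : ‖x‖ ≤ 1) (w : 𝔼 2) :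
    ‖D.tube₀ (x, w)‖ = ‖x‖ := by
  rw [D.tube₀_eq_coneTube h1 h2, D.ν.norm_coneTube]

/-! ### Smoothness of the pieces -/

/-- A framing field is `C^∞` at points of the open disc. [folklore] -/
theorem contDiffAt_n (i : Fin 2) {x : 𝔼 2} (hx : ‖x‖ < 1) : ContDiffAt ℝ ∞ (D.n i) x :=
  (D.contDiffOn_n i).contDiffAt (isOpen_ball.mem_nhds (mem_ball_zero_iff.2 hx))

/-- The fibre coordinates `q ↦ q.2 i` are `C^∞` (a continuous linear map). [folklore] -/
theorem contDiff_snd_apply (i : Fin 2) : ContDiff ℝ ∞ fun q : (𝔼 2) × (𝔼 2) ↦ q.2 i := by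
  have h : ContDiff ℝ ∞
      ((EuclideanSpace.proj (𝕜 := ℝ) i : 𝔼 2 →L[ℝ] ℝ) ∘ (Prod.snd : (𝔼 2) × (𝔼 2) → 𝔼 2)) :=
    (EuclideanSpace.proj (𝕜 := ℝ) i).contDiff.comp contDiff_snd
  simpa [Function.comp_def] using h

/-- The map `q ↦ (q.1, 0)` (projection to the zero section) is `C^∞`. [folklore] -/
theorem contDiff_fst_zero : ContDiff ℝ ∞ fun q : (𝔼 2) × (𝔼 2) ↦ ((q.1, (0 : 𝔼 2)) : (𝔼 2) × (𝔼 2)) :=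
  contDiff_fst.prodMk contDiff_const

/-- The fibre-linear part `(x, w) ↦ w 0 • n 0 x + w 1 • n 1 x` is `C^∞` over the open disc. [folklore] -/
theorem contDiffAt_linPart {x : 𝔼 2} (hx : ‖x‖ < 1) (w : 𝔼 2) :
    ContDiffAt ℝ ∞ (fun q : (𝔼 2) × (𝔼 2) ↦ q.2 0 • D.n 0 q.1 + q.2 1 • D.n 1 q.1) (x, w) := by
  have h0 : ContDiffAt ℝ ∞ (fun q : (𝔼 2) × (𝔼 2) ↦ q.2 0) (x, w) := (contDiff_snd_apply 0).contDiffAt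
  have h1 : ContDiffAt ℝ ∞ (fun q : (𝔼 2) × (𝔼 2) ↦ q.2 1) (x, w) := (contDiff_snd_apply 1).contDiffAt
  have hn0 : ContDiffAt ℝ ∞ (fun q : (𝔼 2) × (𝔼 2) ↦ D.n 0 q.1) (x, w) :=
    (D.contDiffAt_n 0 hx).comp (x, w) contDiffAt_fst
  have hn1 : ContDiffAt ℝ ∞ (fun q : (𝔼 2) × (𝔼 2) ↦ D.n 1 q.1) (x, w) :=
    (D.contDiffAt_n 1 hx).comp (x, w) contDiffAt_fst
  exact (h0.smul hn0).add (h1.smul hn1)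

/-- The affine tube is `C^∞` over the open disc. [folklore] -/
theorem contDiffAt_affine {x : 𝔼 2} (hx : ‖x‖ < 1) (w : 𝔼 2) : ContDiffAt ℝ ∞ D.affine (x, w) := by
  have h : D.affine = fun q : (𝔼 2) × (𝔼 2) ↦ D.g q.1 + (q.2 0 • D.n 0 q.1 + q.2 1 • D.n 1 q.1) := by
    funext q
    rw [D.affine_apply q.1 q.2, add_assoc]
  rw [h]
  exact ((D.isSliceDisc.1.comp contDiff_fst).contDiffAt).add (D.contDiffAt_linPart hx w)

/-- The correction is `C^∞` over the punctured open disc. [folklore] -/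
theorem contDiffAt_corr {x : 𝔼 2} (hx0 : x ≠ 0) (hx : ‖x‖ < 1) (w : 𝔼 2) :
    ContDiffAt ℝ ∞ D.corr (x, w) := by
  have h : D.corr = fun q : (𝔼 2) × (𝔼 2) ↦
      D.ν.coneTube q - D.ν.coneTube (q.1, 0) - (q.2 0 • D.n 0 q.1 + q.2 1 • D.n 1 q.1) := by
    funext q
    exact D.corr_apply q.1 q.2
  rw [h]
  have h1 : ContDiffAt ℝ ∞ D.ν.coneTube (x, w) := D.ν.contDiffAt_coneTube hx0
  have h2 : ContDiffAt ℝ ∞ (fun q : (𝔼 2) × (𝔼 2) ↦ D.ν.coneTube (q.1, 0)) (x, w) :=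
    ContDiffAt.comp (g := D.ν.coneTube) (f := fun q : (𝔼 2) × (𝔼 2) ↦ ((q.1, (0 : 𝔼 2)) : (𝔼 2) × (𝔼 2)))
      (x, w) (D.ν.contDiffAt_coneTube hx0) contDiff_fst_zero.contDiffAt
  exact (h1.sub h2).sub (D.contDiffAt_linPart hx w)

/-- The cutoff factor `cut ‖x‖` is `C^∞` off `x = 0`. [folklore] -/
theorem contDiffAt_cut_norm {x : 𝔼 2} (hx0 : x ≠ 0) (w : 𝔼 2) :
    ContDiffAt ℝ ∞ (fun q : (𝔼 2) × (𝔼 2) ↦ D.cut ‖q.1‖) (x, w) :=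
  D.contDiff_cut.contDiffAt.comp (x, w) ((contDiffAt_norm ℝ hx0).comp (x, w) contDiffAt_fst)

/-- **The unscaled tube is `C^∞` on all of `ℝ² × ℝ²`.** Over the punctured open disc all pieces are
`C^∞`; near `x = 0` (indeed on `‖x‖ < r₁`) the tube is the affine tube; on `‖x‖ > r₂` (in particular
near `‖x‖ ≥ 1`) it is the translated cone tube, `C^∞` off `x = 0` because the disc `g` is `C^∞`
everywhere. [folklore] -/
theorem contDiff_tube₀ : ContDiff ℝ ∞ D.tube₀ := by
  rw [contDiff_iff_contDiffAt]
  rintro ⟨x, w⟩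
  by_cases hr : ‖x‖ < D.r₁
  · -- locally the affine tube
    have hev : D.tube₀ =ᶠ[𝓝 (x, w)] D.affine := by
      have ho : IsOpen {q : (𝔼 2) × (𝔼 2) | ‖q.1‖ < D.r₁} :=
        isOpen_lt (continuous_norm.comp continuous_fst) continuous_const
      filter_upwards [ho.mem_nhds (show ‖x‖ < D.r₁ from hr)] with q hq
      exact D.tube₀_of_le (le_of_lt hq) q.2
    exact (D.contDiffAt_affine (hr.trans D.r₁_lt_one) w).congr_of_eventuallyEq hev
  · have hx0 : x ≠ 0 := by
      rintro rfl
      exact hr (by simpa using D.r₁_pos)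
    by_cases h1 : ‖x‖ < 1
    · exact (D.contDiffAt_affine h1 w).add ((D.contDiffAt_cut_norm hx0 w).smul (D.contDiffAt_corr hx0 h1 w))
    · -- locally the translated cone tube
      have hev : D.tube₀ =ᶠ[𝓝 (x, w)]
          fun q : (𝔼 2) × (𝔼 2) ↦ D.ν.coneTube q + (D.g q.1 - D.ν.coneTube (q.1, 0)) := by
        have ho : IsOpen {q : (𝔼 2) × (𝔼 2) | D.r₂ < ‖q.1‖} :=
          isOpen_lt continuous_const (continuous_norm.comp continuous_fst)
        have hmem : (x, w) ∈ {q : (𝔼 2) × (𝔼 2) | D.r₂ < ‖q.1‖} :=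
          D.r₂_lt_one.trans_le (not_lt.1 h1)
        filter_upwards [ho.mem_nhds hmem] with q hq
        exact D.tube₀_of_ge (le_of_lt hq) q.2
      have h2 : ContDiffAt ℝ ∞ (fun q : (𝔼 2) × (𝔼 2) ↦ D.ν.coneTube (q.1, 0)) (x, w) :=
        ContDiffAt.comp (g := D.ν.coneTube)
          (f := fun q : (𝔼 2) × (𝔼 2) ↦ ((q.1, (0 : 𝔼 2)) : (𝔼 2) × (𝔼 2)))
          (x, w) (D.ν.contDiffAt_coneTube hx0) contDiff_fst_zero.contDiffAt
      have hg : ContDiffAt ℝ ∞ (fun q : (𝔼 2) × (𝔼 2) ↦ D.g q.1) (x, w) :=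
        (D.isSliceDisc.1.comp contDiff_fst).contDiffAt
      exact ((D.ν.contDiffAt_coneTube hx0).add (hg.sub h2)).congr_of_eventuallyEq hev

/-- The unscaled tube is continuous. [folklore] -/
theorem continuous_tube₀ : Continuous D.tube₀ := D.contDiff_tube₀.continuous

/-- The unscaled tube is differentiable. [folklore] -/
theorem differentiable_tube₀ : Differentiable ℝ D.tube₀ := D.contDiff_tube₀.differentiable (by simp)


/-! ### The differential of the tube along the zero section -/

/-- The fibre-linear map `a ↦ a 0 • n 0 x + a 1 • n 1 x` composed with the second projection, as a
continuous linear map `ℝ² × ℝ² → ℝ⁴`. [folklore] -/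
def linDeriv (x : 𝔼 2) : (𝔼 2) × (𝔼 2) →L[ℝ] 𝔼 4 :=
  ((EuclideanSpace.proj (0 : Fin 2)).comp (ContinuousLinearMap.snd ℝ (𝔼 2) (𝔼 2))).smulRight (D.n 0 x) +
    ((EuclideanSpace.proj (1 : Fin 2)).comp (ContinuousLinearMap.snd ℝ (𝔼 2) (𝔼 2))).smulRight (D.n 1 x)

/-- `linDeriv x (v, a) = a 0 • n 0 x + a 1 • n 1 x`. [folklore] -/
@[simp]
theorem linDeriv_apply (x : 𝔼 2) (p : (𝔼 2) × (𝔼 2)) :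
    D.linDeriv x p = p.2 0 • D.n 0 x + p.2 1 • D.n 1 x := by
  simp [linDeriv]

/-- **The differential of the tube along the zero section**: `(v, a) ↦ dgₓ v + a 0 • n 0 x + a 1 • n 1 x`.
[folklore] -/
def zeroDeriv (x : 𝔼 2) : (𝔼 2) × (𝔼 2) →L[ℝ] 𝔼 4 :=
  (fderiv ℝ D.g x).comp (ContinuousLinearMap.fst ℝ (𝔼 2) (𝔼 2)) + D.linDeriv x

/-- `zeroDeriv x (v, a) = dgₓ v + a 0 • n 0 x + a 1 • n 1 x`. [folklore] -/
@[simp]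
theorem zeroDeriv_apply (x : 𝔼 2) (p : (𝔼 2) × (𝔼 2)) :
    D.zeroDeriv x p = fderiv ℝ D.g x p.1 + (p.2 0 • D.n 0 x + p.2 1 • D.n 1 x) := by
  simp [zeroDeriv]

/-- **Transversality**: the differential along the zero section is injective over the open disc.
[folklore] -/
theorem injective_zeroDeriv {x : 𝔼 2} (hx : ‖x‖ < 1) : Injective (D.zeroDeriv x) := by
  refine (injective_iff_map_eq_zero _).2 fun p hp ↦ ?_
  obtain ⟨v, a⟩ := p
  rw [zeroDeriv_apply] at hp
  have h := D.transversal x (mem_ball_zero_iff.2 hx) v a (by rw [Fin.sum_univ_two]; exact hp)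
  rw [h.1, h.2, Prod.mk_zero_zero]

/-- The dimension count `dim (ℝ² × ℝ²) = dim ℝ⁴`. [folklore] -/
theorem finrank_prod_eq : Module.finrank ℝ ((𝔼 2) × (𝔼 2)) = Module.finrank ℝ (𝔼 4) := by
  simp [Module.finrank_prod]

/-- Over the open disc the differential along the zero section is a linear isomorphism
`ℝ² × ℝ² ≃ ℝ⁴` (injective, and the dimensions agree). [folklore] -/
theorem exists_equiv_eq_zeroDeriv {x : 𝔼 2} (hx : ‖x‖ < 1) :
    ∃ e : ((𝔼 2) × (𝔼 2)) ≃L[ℝ] 𝔼 4, (e : (𝔼 2) × (𝔼 2) →L[ℝ] 𝔼 4) = D.zeroDeriv x := by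
  refine ⟨((D.zeroDeriv x : (𝔼 2) × (𝔼 2) →ₗ[ℝ] 𝔼 4).linearEquivOfInjective
    (D.injective_zeroDeriv hx) finrank_prod_eq).toContinuousLinearEquiv, ?_⟩
  exact ContinuousLinearMap.ext fun v ↦ rfl

/-- The derivative of `g ∘ fst` at a point. [folklore] -/
theorem hasFDerivAt_g_fst (x w : 𝔼 2) :
    HasFDerivAt (fun q : (𝔼 2) × (𝔼 2) ↦ D.g q.1)
      ((fderiv ℝ D.g x).comp (ContinuousLinearMap.fst ℝ (𝔼 2) (𝔼 2))) (x, w) :=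
  ((D.isSliceDisc.1.differentiable (by simp)) x).hasFDerivAt.comp (x, w) hasFDerivAt_fst

/-- The derivative of the fibre-linear part `q ↦ q.2 0 • n 0 q.1 + q.2 1 • n 1 q.1` at a point of the
zero section is `linDeriv x` (the terms `wᵢ • dnᵢ` vanish at `w = 0`). [folklore] -/
theorem hasFDerivAt_linPart {x : 𝔼 2} (hx : ‖x‖ < 1) :
    HasFDerivAt (fun q : (𝔼 2) × (𝔼 2) ↦ q.2 0 • D.n 0 q.1 + q.2 1 • D.n 1 q.1) (D.linDeriv x) (x, 0) := by
  have hterm : ∀ i : Fin 2, HasFDerivAt (fun q : (𝔼 2) × (𝔼 2) ↦ q.2 i • D.n i q.1)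
      (((EuclideanSpace.proj i).comp (ContinuousLinearMap.snd ℝ (𝔼 2) (𝔼 2))).smulRight (D.n i x))
      (x, 0) := by
    intro i
    have hc : HasFDerivAt (fun q : (𝔼 2) × (𝔼 2) ↦ q.2 i)
        ((EuclideanSpace.proj i).comp (ContinuousLinearMap.snd ℝ (𝔼 2) (𝔼 2))) (x, 0) :=
      ((EuclideanSpace.proj i).comp (ContinuousLinearMap.snd ℝ (𝔼 2) (𝔼 2))).hasFDerivAt
    have hf : HasFDerivAt (fun q : (𝔼 2) × (𝔼 2) ↦ D.n i q.1)
        ((fderiv ℝ (D.n i) x).comp (ContinuousLinearMap.fst ℝ (𝔼 2) (𝔼 2))) (x, 0) :=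
      (((D.contDiffAt_n i hx).differentiableAt (by simp)).hasFDerivAt).comp (x, 0) hasFDerivAt_fst
    have h := hc.fun_smul hf
    simpa using h
  exact (hterm 0).add (hterm 1)

/-- **The affine tube has differential `zeroDeriv x` along the zero section.** [folklore] -/
theorem hasFDerivAt_affine {x : 𝔼 2} (hx : ‖x‖ < 1) : HasFDerivAt D.affine (D.zeroDeriv x) (x, 0) := by
  have h : D.affine = fun q : (𝔼 2) × (𝔼 2) ↦ D.g q.1 + (q.2 0 • D.n 0 q.1 + q.2 1 • D.n 1 q.1) := by
    funext q
    rw [D.affine_apply q.1 q.2, add_assoc]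
  rw [h]
  exact (D.hasFDerivAt_g_fst x 0).add (D.hasFDerivAt_linPart hx)

/-- The fibre derivative of `ν` at the origin of the fibre over `u`. [folklore] -/
def fibreDeriv (u : 𝕊 1) : (𝔼 2) →L[ℝ] 𝔼 4 :=
  fderiv ℝ (fun w : 𝔼 2 ↦ ((D.ν (u, w) : 𝕊 3) : 𝔼 4)) 0

/-- On the band of the framing, the fibre-linear map of the framing at `t • u` is `t` times the fibre
derivative of `ν` over `u` (the framing is conical over `ν` there). [folklore] -/
theorem linDeriv_eq_of_band {t : ℝ} (h1 : 1 - D.s₂ < t) (h2 : t < 1) (u : 𝕊 1) (a : 𝔼 2) :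
    a 0 • D.n 0 (t • (u : 𝔼 2)) + a 1 • D.n 1 (t • (u : 𝔼 2)) = t • D.fibreDeriv u a := by
  rw [D.n_cone 0 u t h1 h2, D.n_cone 1 u t h1 h2]
  conv_rhs => rw [euclideanSpace_two_decomp a]
  simp only [fibreDeriv, map_add, map_smul, smul_add]
  rw [smul_comm (a 0) t, smul_comm (a 1) t]

/-- **The correction has vanishing differential along the zero section over the band of the framing**
(`1 - s₂ < ‖x‖ < 1`): it vanishes identically on the zero section, and its fibre derivative there is
`∂_w coneTube (x, ·)|₀ - (a ↦ ∑ aᵢ nᵢ x) = ‖x‖ • ∂_w ν(x/‖x‖, ·)|₀ - ‖x‖ • ∂_w ν(x/‖x‖, ·)|₀ = 0`. [folklore] -/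
theorem fderiv_corr_zero {x : 𝔼 2} (h1 : 1 - D.s₂ < ‖x‖) (h2 : ‖x‖ < 1) :
    fderiv ℝ D.corr (x, 0) = 0 := by
  have hx0 : x ≠ 0 := by
    rintro rfl
    rw [norm_zero] at h1
    linarith [D.s₂_lt_one]
  set t : ℝ := ‖x‖ with ht_def
  have ht : 0 < t := norm_pos_iff.2 hx0
  set u : 𝕊 1 := radialProjection (spherePt 1) x with hu
  have hx : t • (u : 𝔼 2) = x := norm_smul_coe_radialProjection _ x
  set f' := fderiv ℝ D.corr (x, 0) with hf'
  have hf : HasFDerivAt D.corr f' (x, 0) :=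
    ((D.contDiffAt_corr hx0 h2 0).differentiableAt (by simp)).hasFDerivAt
  -- along the zero section the correction vanishes identically
  have hinl : f'.comp (ContinuousLinearMap.inl ℝ (𝔼 2) (𝔼 2)) = 0 := by
    have hcomp : HasFDerivAt (D.corr ∘ fun x' : 𝔼 2 ↦ ((x', (0 : 𝔼 2)) : (𝔼 2) × (𝔼 2)))
        (f'.comp (ContinuousLinearMap.inl ℝ (𝔼 2) (𝔼 2))) x :=
      hf.comp x (hasFDerivAt_prodMk_left x (0 : 𝔼 2))
    have hzero : (D.corr ∘ fun x' : 𝔼 2 ↦ ((x', (0 : 𝔼 2)) : (𝔼 2) × (𝔼 2))) = fun _ ↦ 0 := by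
      funext x'
      exact D.corr_fst_zero x'
    rw [hzero] at hcomp
    exact hcomp.unique (hasFDerivAt_const (0 : 𝔼 4) x)
  -- in the fibre direction the two fibre derivatives cancel
  have hinr : f'.comp (ContinuousLinearMap.inr ℝ (𝔼 2) (𝔼 2)) = 0 := by
    have hcomp : HasFDerivAt (D.corr ∘ fun w : 𝔼 2 ↦ ((x, w) : (𝔼 2) × (𝔼 2)))
        (f'.comp (ContinuousLinearMap.inr ℝ (𝔼 2) (𝔼 2))) 0 :=
      hf.comp (0 : 𝔼 2) (hasFDerivAt_prodMk_right x (0 : 𝔼 2))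
    -- the explicit derivative of `w ↦ corr (x, w)` at `0`
    have hcone : HasFDerivAt (fun w : 𝔼 2 ↦ D.ν.coneTube (x, w)) (t • D.fibreDeriv u) 0 := by
      have hd : Differentiable ℝ fun w : 𝔼 2 ↦ D.ν.coneTube (t • (u : 𝔼 2), w) := by
        have : (fun w : 𝔼 2 ↦ D.ν.coneTube (t • (u : 𝔼 2), w)) =
            fun w ↦ t • ((D.ν (u, w) : 𝕊 3) : 𝔼 4) := funext fun w ↦ D.ν.coneTube_smul_coe ht u w
        rw [this]
        exact ((D.ν.contDiff_coe_fibre u).differentiable (by simp)).const_smul t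
      have h := (hd 0).hasFDerivAt
      rw [D.ν.fderiv_coneTube_fibre ht u 0] at h
      rw [← hx]
      exact h
    have hlin : HasFDerivAt (fun w : 𝔼 2 ↦ w 0 • D.n 0 x + w 1 • D.n 1 x)
        ((EuclideanSpace.proj (𝕜 := ℝ) (0 : Fin 2)).smulRight (D.n 0 x) +
          (EuclideanSpace.proj (𝕜 := ℝ) (1 : Fin 2)).smulRight (D.n 1 x)) 0 := by
      have h0 : HasFDerivAt (fun w : 𝔼 2 ↦ w 0) (EuclideanSpace.proj (𝕜 := ℝ) (0 : Fin 2)) 0 :=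
        (EuclideanSpace.proj (𝕜 := ℝ) (0 : Fin 2)).hasFDerivAt
      have h1 : HasFDerivAt (fun w : 𝔼 2 ↦ w 1) (EuclideanSpace.proj (𝕜 := ℝ) (1 : Fin 2)) 0 :=
        (EuclideanSpace.proj (𝕜 := ℝ) (1 : Fin 2)).hasFDerivAt
      exact (h0.smul_const _).add (h1.smul_const _)
    have hexp : HasFDerivAt (D.corr ∘ fun w : 𝔼 2 ↦ ((x, w) : (𝔼 2) × (𝔼 2)))
        (t • D.fibreDeriv u - 0 - ((EuclideanSpace.proj (𝕜 := ℝ) (0 : Fin 2)).smulRight (D.n 0 x) +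
          (EuclideanSpace.proj (𝕜 := ℝ) (1 : Fin 2)).smulRight (D.n 1 x))) 0 := by
      have heq : (D.corr ∘ fun w : 𝔼 2 ↦ ((x, w) : (𝔼 2) × (𝔼 2))) = fun w ↦
          D.ν.coneTube (x, w) - D.ν.coneTube (x, 0) - (w 0 • D.n 0 x + w 1 • D.n 1 x) := by
        funext w
        exact D.corr_apply x w
      rw [heq]
      exact (hcone.sub (hasFDerivAt_const _ _)).sub hlin
    have hval : t • D.fibreDeriv u - 0 - ((EuclideanSpace.proj (𝕜 := ℝ) (0 : Fin 2)).smulRight (D.n 0 x) +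
        (EuclideanSpace.proj (𝕜 := ℝ) (1 : Fin 2)).smulRight (D.n 1 x)) = 0 := by
      ext1 a
      have hband := D.linDeriv_eq_of_band h1 h2 u a
      rw [hx] at hband
      simp [hband]
    rw [hcomp.unique hexp, hval]
  -- assemble
  ext1
  · rw [hinl, ContinuousLinearMap.zero_comp]
  · rw [hinr, ContinuousLinearMap.zero_comp]

/-- The tube agrees with the affine tube near every point with `‖x‖ < r₁`. [folklore] -/
theorem tube₀_eventuallyEq_affine {x : 𝔼 2} (hx : ‖x‖ < D.r₁) (w : 𝔼 2) :
    D.tube₀ =ᶠ[𝓝 (x, w)] D.affine := by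
  have ho : IsOpen {q : (𝔼 2) × (𝔼 2) | ‖q.1‖ < D.r₁} :=
    isOpen_lt (continuous_norm.comp continuous_fst) continuous_const
  filter_upwards [ho.mem_nhds (show ‖x‖ < D.r₁ from hx)] with q hq
  exact D.tube₀_of_le (le_of_lt hq) q.2

/-- The tube agrees with the cone tube near every point over the open conical band
`1 - s₁ < ‖x‖ < 1`. [folklore] -/
theorem tube₀_eventuallyEq_coneTube {x : 𝔼 2} (h1 : 1 - D.s₁ < ‖x‖) (h2 : ‖x‖ < 1) (w : 𝔼 2) :
    D.tube₀ =ᶠ[𝓝 (x, w)] D.ν.coneTube := by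
  have ho : IsOpen {q : (𝔼 2) × (𝔼 2) | 1 - D.s₁ < ‖q.1‖ ∧ ‖q.1‖ < 1} :=
    (isOpen_lt continuous_const (continuous_norm.comp continuous_fst)).inter
      (isOpen_lt (continuous_norm.comp continuous_fst) continuous_const)
  filter_upwards [ho.mem_nhds (show 1 - D.s₁ < ‖x‖ ∧ ‖x‖ < 1 from ⟨h1, h2⟩)] with q hq
  exact D.tube₀_eq_coneTube hq.1.le hq.2.le q.2

/-- **The tube has differential `zeroDeriv x` along the zero section** over the open disc: below `r₁`
it is the affine tube near the point; elsewhere the cutoff term `cut ‖x‖ • corr` has differential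
`cut ‖x‖ • d(corr) + d(cut ‖·‖) ⊗ corr (x, 0) = 0` there (`fderiv_corr_zero`, `corr (x, 0) = 0`).
[folklore] -/
theorem hasFDerivAt_tube₀_zero {x : 𝔼 2} (hx : ‖x‖ < 1) : HasFDerivAt D.tube₀ (D.zeroDeriv x) (x, 0) := by
  by_cases hr : ‖x‖ < D.r₁
  · exact (D.hasFDerivAt_affine (hr.trans D.r₁_lt_one)).congr_of_eventuallyEq
      (D.tube₀_eventuallyEq_affine hr 0)
  · have hr' : D.r₁ ≤ ‖x‖ := not_lt.1 hr
    have hx0 : x ≠ 0 := by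
      rintro rfl
      exact hr (by simpa using D.r₁_pos)
    have hband : 1 - D.s₂ < ‖x‖ := D.one_sub_s₂_lt_r₁.trans_le hr'
    have hc : HasFDerivAt (fun q : (𝔼 2) × (𝔼 2) ↦ D.cut ‖q.1‖)
        (fderiv ℝ (fun q : (𝔼 2) × (𝔼 2) ↦ D.cut ‖q.1‖) (x, 0)) (x, 0) :=
      ((D.contDiffAt_cut_norm hx0 0).differentiableAt (by simp)).hasFDerivAt
    have hf : HasFDerivAt D.corr (fderiv ℝ D.corr (x, 0)) (x, 0) :=
      ((D.contDiffAt_corr hx0 hx 0).differentiableAt (by simp)).hasFDerivAt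
    have hΦ := hc.smul hf
    rw [D.fderiv_corr_zero hband hx, smul_zero, zero_add, D.corr_fst_zero,
      ContinuousLinearMap.smulRight_zero] at hΦ
    have h := (D.hasFDerivAt_affine hx).add hΦ
    rw [add_zero] at h
    exact h

/-- The Fréchet derivative of the tube at a point of the zero section. [folklore] -/
theorem fderiv_tube₀_zero {x : 𝔼 2} (hx : ‖x‖ < 1) : fderiv ℝ D.tube₀ (x, 0) = D.zeroDeriv x :=
  (D.hasFDerivAt_tube₀_zero hx).fderiv

/-- Along the zero section over the open disc the derivative of the tube is invertible. [folklore] -/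
theorem fderiv_tube₀_zero_mem_range {x : 𝔼 2} (hx : ‖x‖ < 1) :
    fderiv ℝ D.tube₀ (x, 0) ∈ range ((↑) : (((𝔼 2) × (𝔼 2)) ≃L[ℝ] 𝔼 4) → (𝔼 2) × (𝔼 2) →L[ℝ] 𝔼 4) := by
  obtain ⟨e, he⟩ := D.exists_equiv_eq_zeroDeriv hx
  exact ⟨e, by rw [he, D.fderiv_tube₀_zero hx]⟩

/-- **Local injectivity of the tube at the zero section** (inverse function theorem: the tube is `C^∞`
with invertible differential there). [folklore] -/
theorem exists_nhds_injOn {x : 𝔼 2} (hx : ‖x‖ < 1) :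
    ∃ U ∈ 𝓝 ((x, 0) : (𝔼 2) × (𝔼 2)), InjOn D.tube₀ U := by
  obtain ⟨e, he⟩ := D.exists_equiv_eq_zeroDeriv hx
  have hstrict : HasStrictFDerivAt D.tube₀ (e : (𝔼 2) × (𝔼 2) →L[ℝ] 𝔼 4) (x, 0) := by
    have h := D.contDiff_tube₀.contDiffAt.hasStrictFDerivAt (x := ((x, 0) : (𝔼 2) × (𝔼 2))) (by simp)
    rwa [D.fderiv_tube₀_zero hx, ← he] at h
  refine ⟨(hstrict.toOpenPartialHomeomorph D.tube₀).source,
    (hstrict.toOpenPartialHomeomorph D.tube₀).open_source.mem_nhds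
      hstrict.mem_toOpenPartialHomeomorph_source, ?_⟩
  have h := (hstrict.toOpenPartialHomeomorph D.tube₀).injOn
  rwa [HasStrictFDerivAt.toOpenPartialHomeomorph_coe] at h


/-! ### Uniform estimates around the zero section -/

/-- **The deep part of the disc stays away from the boundary sphere**: `‖g x‖ ≤ m₀ < 1` for
`‖x‖ ≤ 1 - s₁` (compactness, and `g` maps the open disc into the open ball). [folklore] -/
theorem exists_bound_g : ∃ m₀ : ℝ, m₀ < 1 ∧ ∀ x : 𝔼 2, ‖x‖ ≤ 1 - D.s₁ → ‖D.g x‖ ≤ m₀ := by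
  have hK : IsCompact (closedBall (0 : 𝔼 2) (1 - D.s₁)) := isCompact_closedBall _ _
  have hne : (closedBall (0 : 𝔼 2) (1 - D.s₁)).Nonempty :=
    ⟨0, mem_closedBall_zero_iff.2 (by simpa using D.s₁_lt_one.le)⟩
  have hcont : ContinuousOn (fun x : 𝔼 2 ↦ ‖D.g x‖) (closedBall (0 : 𝔼 2) (1 - D.s₁)) :=
    (continuous_norm.comp D.isSliceDisc.1.continuous).continuousOn
  obtain ⟨x₀, hx₀, hmax⟩ := hK.exists_isMaxOn hne hcont
  refine ⟨‖D.g x₀‖, ?_, fun x hx ↦ hmax (mem_closedBall_zero_iff.2 hx)⟩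
  exact D.isSliceDisc.2.2.2.1 x₀ (by linarith [mem_closedBall_zero_iff.1 hx₀, D.s₁_pos])

/-- **A thin tube over the deep disc stays in a smaller ball**: if `‖g x‖ < ρ` for `‖x‖ ≤ 1 - s₁` then
`‖G₀ (x, w)‖ < ρ` for `‖x‖ ≤ 1 - s₁`, `‖w‖ < ε` (tube lemma over the compact deep disc). [folklore] -/
theorem exists_norm_lt {ρ : ℝ} (hρ : ∀ x : 𝔼 2, ‖x‖ ≤ 1 - D.s₁ → ‖D.g x‖ < ρ) :
    ∃ ε > 0, ∀ x w : 𝔼 2, ‖x‖ ≤ 1 - D.s₁ → ‖w‖ < ε → ‖D.tube₀ (x, w)‖ < ρ := by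
  have hopen : IsOpen {q : (𝔼 2) × (𝔼 2) | ‖D.tube₀ q‖ < ρ} :=
    isOpen_lt (continuous_norm.comp D.continuous_tube₀) continuous_const
  have hsub : closedBall (0 : 𝔼 2) (1 - D.s₁) ×ˢ ({0} : Set (𝔼 2)) ⊆ {q | ‖D.tube₀ q‖ < ρ} := by
    rintro ⟨x, w⟩ ⟨hx, hw⟩
    rw [mem_singleton_iff] at hw
    subst hw
    change ‖D.tube₀ (x, 0)‖ < ρ
    rw [D.tube₀_fst_zero]
    exact hρ x (mem_closedBall_zero_iff.1 hx)
  obtain ⟨U, V, -, hV, hU, h0V, hUV⟩ :=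
    generalized_tube_lemma (isCompact_closedBall _ _) isCompact_singleton hopen hsub
  obtain ⟨ε, hε, hball⟩ := Metric.isOpen_iff.1 hV 0 (h0V rfl)
  exact ⟨ε, hε, fun x w hx hw ↦
    hUV ⟨hU (mem_closedBall_zero_iff.2 hx), hball (mem_ball_zero_iff.2 hw)⟩⟩

/-- **The derivative of the tube is invertible on a thin tube** over any compact sub-disc
`‖x‖ ≤ R < 1` (invertibility is open, and holds along the zero section). [folklore] -/
theorem exists_fderiv_mem_range {R : ℝ} (hR : R < 1) :
    ∃ ε > 0, ∀ x w : 𝔼 2, ‖x‖ ≤ R → ‖w‖ < ε →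
      fderiv ℝ D.tube₀ (x, w) ∈
        range ((↑) : (((𝔼 2) × (𝔼 2)) ≃L[ℝ] 𝔼 4) → (𝔼 2) × (𝔼 2) →L[ℝ] 𝔼 4) := by
  have hcont : Continuous (fderiv ℝ D.tube₀) := D.contDiff_tube₀.continuous_fderiv (by simp)
  have hopen : IsOpen ((fderiv ℝ D.tube₀) ⁻¹'
      range ((↑) : (((𝔼 2) × (𝔼 2)) ≃L[ℝ] 𝔼 4) → (𝔼 2) × (𝔼 2) →L[ℝ] 𝔼 4)) :=
    ContinuousLinearEquiv.isOpen.preimage hcont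
  have hsub : closedBall (0 : 𝔼 2) R ×ˢ ({0} : Set (𝔼 2)) ⊆ (fderiv ℝ D.tube₀) ⁻¹'
      range ((↑) : (((𝔼 2) × (𝔼 2)) ≃L[ℝ] 𝔼 4) → (𝔼 2) × (𝔼 2) →L[ℝ] 𝔼 4) := by
    rintro ⟨x, w⟩ ⟨hx, hw⟩
    rw [mem_singleton_iff] at hw
    subst hw
    exact D.fderiv_tube₀_zero_mem_range ((mem_closedBall_zero_iff.1 hx).trans_lt hR)
  obtain ⟨U, V, -, hV, hU, h0V, hUV⟩ :=
    generalized_tube_lemma (isCompact_closedBall _ _) isCompact_singleton hopen hsub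
  obtain ⟨ε, hε, hball⟩ := Metric.isOpen_iff.1 hV 0 (h0V rfl)
  exact ⟨ε, hε, fun x w hx hw ↦
    hUV ⟨hU (mem_closedBall_zero_iff.2 hx), hball (mem_ball_zero_iff.2 hw)⟩⟩

/-- **The tube is injective on a thin tube** over any compact sub-disc `‖x‖ ≤ R < 1`: it is injective
on the zero section (where it is the disc `g`) and locally injective at each of its points
(`exists_nhds_injOn`), so `exists_injOn_prod_ball` applies. [folklore] -/
theorem exists_injOn {R : ℝ} (hR : R < 1) :
    ∃ ε > 0, ∀ x w x' w' : 𝔼 2, ‖x‖ ≤ R → ‖w‖ < ε → ‖x'‖ ≤ R → ‖w'‖ < ε →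
      D.tube₀ (x, w) = D.tube₀ (x', w') → x = x' ∧ w = w' := by
  haveI : CompactSpace (closedBall (0 : 𝔼 2) R) :=
    isCompact_iff_compactSpace.1 (isCompact_closedBall _ _)
  let ι : (closedBall (0 : 𝔼 2) R) × (𝔼 2) → (𝔼 2) × (𝔼 2) := fun p ↦ ((p.1 : 𝔼 2), p.2)
  have hι : Continuous ι := (continuous_subtype_val.comp continuous_fst).prodMk continuous_snd
  have hιinj : Injective ι := by
    rintro ⟨a, v⟩ ⟨b, v'⟩ hab
    simp only [ι, Prod.mk.injEq] at hab
    exact Prod.ext (Subtype.ext hab.1) hab.2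
  set G : (closedBall (0 : 𝔼 2) R) × (𝔼 2) → 𝔼 4 := D.tube₀ ∘ ι with hG
  have hGc : Continuous G := D.continuous_tube₀.comp hι
  have hmem : ∀ p : closedBall (0 : 𝔼 2) R, (p : 𝔼 2) ∈ closedBall (0 : 𝔼 2) 1 := fun p ↦
    closedBall_subset_closedBall hR.le p.2
  have h0 : Injective fun p : closedBall (0 : 𝔼 2) R ↦ G (p, 0) := by
    intro p p' h
    have h' : D.g p = D.g p' := by simpa [hG, ι] using h
    exact Subtype.ext (D.isSliceDisc.2.1 (hmem p) (hmem p') h')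
  have hloc : ∀ p : closedBall (0 : 𝔼 2) R, ∃ U ∈ 𝓝 (p, (0 : 𝔼 2)), InjOn G U := by
    intro p
    obtain ⟨U, hU, hinj⟩ :=
      D.exists_nhds_injOn (x := (p : 𝔼 2)) ((mem_closedBall_zero_iff.1 p.2).trans_lt hR)
    refine ⟨ι ⁻¹' U, hι.continuousAt.preimage_mem_nhds hU, ?_⟩
    intro a ha b hb hab
    exact hιinj (hinj ha hb hab)
  obtain ⟨ε, hε, hinj⟩ := exists_injOn_prod_ball hGc h0 hloc
  refine ⟨ε, hε, fun x w x' w' hx hw hx' hw' h ↦ ?_⟩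
  have key := @hinj (⟨x, mem_closedBall_zero_iff.2 hx⟩, w) ⟨mem_univ _, mem_ball_zero_iff.2 hw⟩
    (⟨x', mem_closedBall_zero_iff.2 hx'⟩, w') ⟨mem_univ _, mem_ball_zero_iff.2 hw'⟩ h
  exact ⟨congrArg (fun p ↦ ((p.1 : closedBall (0 : 𝔼 2) R) : 𝔼 2)) key, congrArg Prod.snd key⟩

/-! ### The conical tube -/

/-- The fibre rescaling `(x, w) ↦ (x, c • w)` as a continuous linear map. [folklore] -/
def fibreScale (c : ℝ) : (𝔼 2) × (𝔼 2) →L[ℝ] (𝔼 2) × (𝔼 2) :=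
  (ContinuousLinearMap.fst ℝ (𝔼 2) (𝔼 2)).prod (c • ContinuousLinearMap.snd ℝ (𝔼 2) (𝔼 2))

/-- The fibre rescaling on points. [folklore] -/
@[simp]
theorem fibreScale_apply (c : ℝ) (q : (𝔼 2) × (𝔼 2)) : fibreScale c q = (q.1, c • q.2) := rfl

/-- The fibre rescaling is injective for `c ≠ 0`. [folklore] -/
theorem injective_fibreScale {c : ℝ} (hc : c ≠ 0) : Injective (fibreScale c) := by
  intro a b h
  simp only [fibreScale_apply, Prod.mk.injEq] at h
  exact Prod.ext h.1 (smul_right_injective _ hc h.2)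

/-- **The conical tube of a slice disc with a conical transversal framing** (Kosinski (1993), Ch. III
(4.1)–(4.2), in coordinates). For the datum `D` there are a fibre scale `0 < c ≤ 1`, a width
`0 < s₀ < s₁` and a map `G : ℝ² × ℝ² → ℝ⁴` (namely `G (x, w) = G₀ (x, c • w)`) which on `D̊² × B(0, 2)`
is a `C^∞` injective immersion into the open unit ball, restricts to the disc on the zero section,
is the cone `G (t • u, w) = t • ν(u, c • w) = t • (ν.scale c) (u, w)` over the band `1 - s₁ < t < 1`,
and keeps the deep part deep (`‖G (x, w)‖ ≤ 1 - s₀` for `‖x‖ ≤ 1 - s₀`). Proof: the unscaled tube `G₀`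
is `C^∞` with invertible differential along the zero section (transversality of the framing); it is
injective and immersive on a thin tube over the compact disc `‖x‖ ≤ 1 - s₀` (`exists_injOn`,
`exists_fderiv_mem_range`), equal to the cone tube — injective and immersive with norm `‖x‖` — over
the band `1 - s₁ < ‖x‖ < 1`, and of norm `< ρ ≤ 1 - s₀` over the deep disc `‖x‖ ≤ 1 - s₁`
(`exists_norm_lt`), which separates the two regions; rescaling the fibre by `c` puts `B(0, 2)` inside
all the thin tubes. [cite: Kosinski1993, Ch. III Thm (4.2)] -/
theorem exists_conicalTube :
    ∃ (c : ℝ) (hc : 0 < c) (s₀ : ℝ) (G : (𝔼 2) × (𝔼 2) → 𝔼 4),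
      c ≤ 1 ∧ 0 < s₀ ∧ s₀ < D.s₁ ∧
      (∀ q, G q = D.tube₀ (q.1, c • q.2)) ∧
      ContDiffOn ℝ ∞ G (ball (0 : 𝔼 2) 1 ×ˢ ball (0 : 𝔼 2) 2) ∧
      InjOn G (ball (0 : 𝔼 2) 1 ×ˢ ball (0 : 𝔼 2) 2) ∧
      (∀ q ∈ ball (0 : 𝔼 2) 1 ×ˢ ball (0 : 𝔼 2) 2, Injective (fderiv ℝ G q)) ∧
      (∀ q ∈ ball (0 : 𝔼 2) 1 ×ˢ ball (0 : 𝔼 2) 2, G q ∈ ball (0 : 𝔼 4) 1) ∧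
      (∀ x ∈ ball (0 : 𝔼 2) 1, G (x, 0) = D.g x) ∧
      (∀ (u : 𝕊 1) (t : ℝ) (w : 𝔼 2), 1 - D.s₁ < t → t < 1 → ‖w‖ < 2 →
        G (t • (u : 𝔼 2), w) = t • (((D.ν.scale c hc) (u, w) : 𝕊 3) : 𝔼 4)) ∧
      (∀ x w : 𝔼 2, ‖x‖ ≤ 1 - s₀ → ‖w‖ < 2 → ‖G (x, w)‖ ≤ 1 - s₀) := by
  -- the constants
  obtain ⟨m₀, hm₀, hgm⟩ := D.exists_bound_g
  set ρ : ℝ := (1 + m₀) / 2 with hρ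
  have hρ1 : ρ < 1 := by rw [hρ]; linarith
  have hmρ : m₀ < ρ := by rw [hρ]; linarith
  set s₀ : ℝ := min (D.s₁ / 2) (1 - ρ) with hs₀
  have hs₀_pos : 0 < s₀ := lt_min (by linarith [D.s₁_pos]) (by linarith)
  have hs₀_lt : s₀ < D.s₁ := (min_le_left _ _).trans_lt (by linarith [D.s₁_pos])
  have hρs₀ : ρ ≤ 1 - s₀ := by
    have := min_le_right (D.s₁ / 2) (1 - ρ)
    linarith
  have hR : 1 - s₀ < 1 := by linarith
  obtain ⟨ε₁, hε₁, hnorm⟩ := D.exists_norm_lt (ρ := ρ) fun x hx ↦ (hgm x hx).trans_lt hmρ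
  obtain ⟨ε₂, hε₂, hder⟩ := D.exists_fderiv_mem_range hR
  obtain ⟨ε₃, hε₃, hinj⟩ := D.exists_injOn hR
  set c : ℝ := min 1 (min ε₁ (min ε₂ ε₃)) / 2 with hc_def
  have hmin : 0 < min 1 (min ε₁ (min ε₂ ε₃)) := lt_min one_pos (lt_min hε₁ (lt_min hε₂ hε₃))
  have hc : 0 < c := by rw [hc_def]; linarith
  have hc1 : c ≤ 1 := by
    have := min_le_left 1 (min ε₁ (min ε₂ ε₃))
    rw [hc_def]; linarith
  have hcε₁ : 2 * c ≤ ε₁ := by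
    have := (min_le_right 1 _).trans (min_le_left ε₁ (min ε₂ ε₃))
    rw [hc_def]; linarith
  have hcε₂ : 2 * c ≤ ε₂ := by
    have := ((min_le_right 1 _).trans (min_le_right ε₁ _)).trans (min_le_left ε₂ ε₃)
    rw [hc_def]; linarith
  have hcε₃ : 2 * c ≤ ε₃ := by
    have := ((min_le_right 1 _).trans (min_le_right ε₁ _)).trans (min_le_right ε₂ ε₃)
    rw [hc_def]; linarith
  have hcw : ∀ {w : 𝔼 2} {ε : ℝ}, 2 * c ≤ ε → ‖w‖ < 2 → ‖c • w‖ < ε := by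
    intro w ε hε hw
    rw [norm_smul, Real.norm_of_nonneg hc.le]
    nlinarith
  -- the three regimes of the unscaled tube
  have hdeep : ∀ {y v : 𝔼 2}, ‖y‖ ≤ 1 - D.s₁ → ‖v‖ < 2 → ‖D.tube₀ (y, c • v)‖ < ρ :=
    fun hy hv ↦ hnorm _ _ hy (hcw hcε₁ hv)
  have hband : ∀ {y : 𝔼 2} (v : 𝔼 2), 1 - D.s₁ < ‖y‖ → ‖y‖ < 1 → ‖D.tube₀ (y, v)‖ = ‖y‖ :=
    fun v h1 h2 ↦ D.norm_tube₀_of_band h1.le h2.le v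
  have hs₀s₁ : 1 - D.s₁ < 1 - s₀ := by linarith
  -- two band points with the same image coincide
  have hband_inj : ∀ {y v y' v' : 𝔼 2}, 1 - D.s₁ < ‖y‖ → ‖y‖ < 1 → 1 - D.s₁ < ‖y'‖ → ‖y'‖ < 1 →
      D.tube₀ (y, c • v) = D.tube₀ (y', c • v') → ((y, v) : (𝔼 2) × (𝔼 2)) = (y', v') := by
    intro y v y' v' h1 h2 h1' h2' h
    rw [D.tube₀_eq_coneTube h1.le h2.le, D.tube₀_eq_coneTube h1'.le h2'.le] at h
    have hy0 : y ≠ 0 := by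
      rintro rfl
      rw [norm_zero] at h1
      linarith [D.s₁_lt_one]
    have hy0' : y' ≠ 0 := by
      rintro rfl
      rw [norm_zero] at h1'
      linarith [D.s₁_lt_one]
    have key := D.ν.injOn_coneTube (show ((y, c • v) : (𝔼 2) × (𝔼 2)).1 ≠ 0 from hy0)
      (show ((y', c • v') : (𝔼 2) × (𝔼 2)).1 ≠ 0 from hy0') h
    simp only [Prod.mk.injEq] at key
    exact Prod.ext key.1 (smul_right_injective _ hc.ne' key.2)
  -- a deep point and a collar point have different images
  have hsep : ∀ {y v y' v' : 𝔼 2}, ‖y‖ ≤ 1 - D.s₁ → ‖v‖ < 2 → 1 - s₀ < ‖y'‖ → ‖y'‖ < 1 →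
      D.tube₀ (y, c • v) ≠ D.tube₀ (y', c • v') := by
    intro y v y' v' hy hv h1' h2' h
    have hlt := hdeep hy hv
    rw [h, hband (c • v') (hs₀s₁.trans h1') h2'] at hlt
    linarith
  set G : (𝔼 2) × (𝔼 2) → 𝔼 4 := fun q ↦ D.tube₀ (q.1, c • q.2) with hG
  have hGS : G = D.tube₀ ∘ fibreScale c := by
    funext q
    rfl
  refine ⟨c, hc, s₀, G, hc1, hs₀_pos, hs₀_lt, fun q ↦ rfl, ?_, ?_, ?_, ?_, ?_, ?_, ?_⟩
  · -- smooth
    rw [hGS]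
    exact (D.contDiff_tube₀.comp (fibreScale c).contDiff).contDiffOn
  · -- injective
    rintro ⟨x, w⟩ ⟨hx, hw⟩ ⟨x', w'⟩ ⟨hx', hw'⟩ h
    rw [mem_ball_zero_iff] at hx hw hx' hw'
    change D.tube₀ (x, c • w) = D.tube₀ (x', c • w') at h
    by_cases hxs : ‖x‖ ≤ 1 - s₀ <;> by_cases hxs' : ‖x'‖ ≤ 1 - s₀
    · obtain ⟨h1, h2⟩ := hinj x (c • w) x' (c • w') hxs (hcw hcε₃ hw) hxs' (hcw hcε₃ hw') h
      exact Prod.ext h1 (smul_right_injective _ hc.ne' h2)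
    · rw [not_le] at hxs'
      by_cases hx1 : ‖x‖ ≤ 1 - D.s₁
      · exact absurd h (hsep hx1 hw hxs' hx')
      · exact hband_inj (not_le.1 hx1) hx (hs₀s₁.trans hxs') hx' h
    · rw [not_le] at hxs
      by_cases hx1' : ‖x'‖ ≤ 1 - D.s₁
      · exact absurd h.symm (hsep hx1' hw' hxs hx)
      · exact hband_inj (hs₀s₁.trans hxs) hx (not_le.1 hx1') hx' h
    · rw [not_le] at hxs hxs'
      exact hband_inj (hs₀s₁.trans hxs) hx (hs₀s₁.trans hxs') hx' h
  · -- immersion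
    rintro ⟨x, w⟩ ⟨hx, hw⟩
    rw [mem_ball_zero_iff] at hx hw
    have hT : HasFDerivAt D.tube₀ (fderiv ℝ D.tube₀ (x, c • w)) (fibreScale c (x, w)) :=
      (D.differentiable_tube₀ _).hasFDerivAt
    have hcomp : HasFDerivAt G ((fderiv ℝ D.tube₀ (x, c • w)).comp (fibreScale c)) (x, w) := by
      rw [hGS]
      exact hT.comp (x, w) (fibreScale c).hasFDerivAt
    rw [hcomp.fderiv, ContinuousLinearMap.coe_comp]
    refine Injective.comp ?_ (injective_fibreScale hc.ne')
    by_cases hxs : ‖x‖ ≤ 1 - s₀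
    · obtain ⟨e, he⟩ := hder x (c • w) hxs (hcw hcε₂ hw)
      rw [← he]
      exact e.injective
    · rw [not_le] at hxs
      have h1 : 1 - D.s₁ < ‖x‖ := hs₀s₁.trans hxs
      rw [(D.tube₀_eventuallyEq_coneTube h1 hx (c • w)).fderiv_eq]
      have hx0 : x ≠ 0 := by
        rintro rfl
        rw [norm_zero] at h1
        linarith [D.s₁_lt_one]
      exact D.ν.injective_fderiv_coneTube (show ((x, c • w) : (𝔼 2) × (𝔼 2)).1 ≠ 0 from hx0)
  · -- into the open unit ball
    rintro ⟨x, w⟩ ⟨hx, hw⟩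
    rw [mem_ball_zero_iff] at hx hw
    rw [mem_ball_zero_iff]
    change ‖D.tube₀ (x, c • w)‖ < 1
    by_cases h : ‖x‖ ≤ 1 - D.s₁
    · exact (hdeep h hw).trans hρ1
    · rw [hband (c • w) (not_le.1 h) hx]
      exact hx
  · -- the zero section
    intro x _
    change D.tube₀ (x, c • 0) = D.g x
    rw [smul_zero, tube₀_fst_zero]
  · -- the cone over the rescaled tube
    intro u t w ht1 ht2 _
    change D.tube₀ (t • (u : 𝔼 2), c • w) = t • (((D.ν.scale c hc) (u, w) : 𝕊 3) : 𝔼 4)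
    rw [D.tube₀_smul_coe ht1.le ht2.le, Knot.TubularNbhd.scale_apply]
  · -- the deep part stays deep
    intro x w hx hw
    change ‖D.tube₀ (x, c • w)‖ ≤ 1 - s₀
    by_cases h : ‖x‖ ≤ 1 - D.s₁
    · exact (hdeep h hw).le.trans hρs₀
    · rw [hband (c • w) (not_le.1 h) (hx.trans_lt hR)]
      exact hx

/-- **The conical tube, in the shape of `Knot.IsSliceDisc.exists_conicalTube_hasFraming_zero`.** If the
tubular neighbourhood `ν` of the datum has framing `m`, the delivered rescaled tube `ν.scale c` has
framing `m` (`HasFraming.scale`), and the tube `G` has all the properties listed in that named fact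
(with `m` for `0`). [cite: Kosinski1993, Ch. III Thm (4.2)] -/
theorem exists_conicalTube_hasFraming {m : ℤ} (hν : D.ν.HasFraming m) :
    ∃ (ν' : Knot.TubularNbhd K) (_ : ν'.HasFraming m) (s₀ : ℝ) (G : (𝔼 2) × (𝔼 2) → 𝔼 4),
      0 < s₀ ∧ s₀ < D.s₁ ∧
      ContDiffOn ℝ ∞ G (ball (0 : 𝔼 2) 1 ×ˢ ball (0 : 𝔼 2) 2) ∧
      InjOn G (ball (0 : 𝔼 2) 1 ×ˢ ball (0 : 𝔼 2) 2) ∧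
      (∀ q ∈ ball (0 : 𝔼 2) 1 ×ˢ ball (0 : 𝔼 2) 2, Injective (fderiv ℝ G q)) ∧
      (∀ q ∈ ball (0 : 𝔼 2) 1 ×ˢ ball (0 : 𝔼 2) 2, G q ∈ ball (0 : 𝔼 4) 1) ∧
      (∀ x ∈ ball (0 : 𝔼 2) 1, G (x, 0) = D.g x) ∧
      (∀ (u : 𝕊 1) (t : ℝ) (w : 𝔼 2), 1 - D.s₁ < t → t < 1 → ‖w‖ < 2 →
        G (t • (u : 𝔼 2), w) = t • ((ν' (u, w) : 𝕊 3) : 𝔼 4)) ∧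
      (∀ x w : 𝔼 2, ‖x‖ ≤ 1 - s₀ → ‖w‖ < 2 → ‖G (x, w)‖ ≤ 1 - s₀) := by
  obtain ⟨c, hc, s₀, G, -, hs₀, hs₀', -, h1, h2, h3, h4, h5, h6, h7⟩ := D.exists_conicalTube
  exact ⟨D.ν.scale c hc, Knot.TubularNbhd.HasFraming.scale D.ν c hc hν, s₀, G, hs₀, hs₀', h1, h2, h3, h4,
    h5, h6, h7⟩

end ConicalFraming

/-- **A slice disc with a conical transversal framing over a tubular neighbourhood of framing `m` has a
framed conical tube** — the statement of `Knot.IsSliceDisc.exists_conicalTube_hasFraming_zero` with its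
two classical inputs made hypotheses: the transversal framing `n` of the disc, conical over `ν` on a
band `1 - s₂ < ‖x‖ < 1` (Kosinski (1993), Ch. III (4.1)–(4.2)), and the framing integer of `ν` (which
is `0` by Kirby (1989), Ch. I §2, p. 6). [cite: Kosinski1993, Ch. III Thm (4.2)] -/
theorem Knot.IsSliceDisc.exists_conicalTube_of_conicalFraming {K : Knot} {g₁ : 𝔼 2 → 𝔼 4} {s₁ : ℝ}
    (hg : K.IsSliceDisc g₁) (hs₁ : 0 < s₁)
    (hcone : ∀ (u : 𝕊 1) (t : ℝ), 1 - s₁ ≤ t → t ≤ 1 →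
      g₁ (t • (u : 𝔼 2)) = t • ((K u : 𝕊 3) : 𝔼 4))
    (ν : Knot.TubularNbhd K) {m : ℤ} (hν : ν.HasFraming m) {s₂ : ℝ} (hs₁₂ : s₁ < s₂) (hs₂ : s₂ < 1)
    (n : Fin 2 → 𝔼 2 → 𝔼 4) (hn : ∀ i, ContDiffOn ℝ ∞ (n i) (ball (0 : 𝔼 2) 1))
    (htr : ∀ x ∈ ball (0 : 𝔼 2) 1, ∀ (v a : 𝔼 2), fderiv ℝ g₁ x v + ∑ i, a i • n i x = 0 → v = 0 ∧ a = 0)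
    (hnc : ∀ (i : Fin 2) (u : 𝕊 1) (t : ℝ), 1 - s₂ < t → t < 1 →
      n i (t • (u : 𝔼 2)) = t • fderiv ℝ (fun w : 𝔼 2 ↦ ((ν (u, w) : 𝕊 3) : 𝔼 4)) 0 (EuclideanSpace.single i 1)) :
    ∃ (ν' : Knot.TubularNbhd K) (_ : ν'.HasFraming m) (s₀ : ℝ) (G : (𝔼 2) × (𝔼 2) → 𝔼 4),
      0 < s₀ ∧ s₀ < s₁ ∧
      ContDiffOn ℝ ∞ G (ball (0 : 𝔼 2) 1 ×ˢ ball (0 : 𝔼 2) 2) ∧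
      InjOn G (ball (0 : 𝔼 2) 1 ×ˢ ball (0 : 𝔼 2) 2) ∧
      (∀ q ∈ ball (0 : 𝔼 2) 1 ×ˢ ball (0 : 𝔼 2) 2, Injective (fderiv ℝ G q)) ∧
      (∀ q ∈ ball (0 : 𝔼 2) 1 ×ˢ ball (0 : 𝔼 2) 2, G q ∈ ball (0 : 𝔼 4) 1) ∧
      (∀ x ∈ ball (0 : 𝔼 2) 1, G (x, 0) = g₁ x) ∧
      (∀ (u : 𝕊 1) (t : ℝ) (w : 𝔼 2), 1 - s₁ < t → t < 1 → ‖w‖ < 2 →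
        G (t • (u : 𝔼 2), w) = t • ((ν' (u, w) : 𝕊 3) : 𝔼 4)) ∧
      (∀ x w : 𝔼 2, ‖x‖ ≤ 1 - s₀ → ‖w‖ < 2 → ‖G (x, w)‖ ≤ 1 - s₀) :=
  ConicalFraming.exists_conicalTube_hasFraming
    { g := g₁, s₁ := s₁, s₂ := s₂, ν := ν, n := n, isSliceDisc := hg, s₁_pos := hs₁, s₁_lt_s₂ := hs₁₂,
      s₂_lt_one := hs₂, g_cone := hcone, contDiffOn_n := hn, transversal := htr, n_cone := hnc } hν

end Literature.Topology.FourManifolds
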